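import Mathlib
import HarnessLib
import Summits.NavierStokesRegularity.NavierStokesRegularity.Theorems.PoloidalWindowDoorPoloidalWindowRigidityNearIdentityExtraction
import Summits.NavierStokesRegularity.NavierStokesRegularity.Theorems.PoloidalWindowDoorPoloidalWindowRigidityPointGroupCentre

/-!
# Crux `PoloidalWindowRigidity` (stmt-NavierStokesRegularity-19708) — LINE 32 «crystal», ANNEX 2 `crystal_lattice`
# (ideator ns-idea-8 g14): THE CRYSTAL THEOREM and the GLOBAL AXIS/CENTRE STRUCTURE, class level, PORT-READY

Everything here is PROVED (no `sorry`), imports only landed `Theorems/` + Mathlib, and is stated over the port's objects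
`IsScrew` / `IsScrewAbout` (`Theorems/…NearIdentityDefs`), so a typer may land it verbatim as
`Theorems/PoloidalWindowDoorPoloidalWindowRigidityCrystal.lean --supports stmt-NavierStokesRegularity-19708`.
It is the import-free core of §44–§45 of the skeleton `Cruxes/PoloidalWindowRigidity/Lines/crystal.lean` (e88190e44f69)
plus a NEW §C.  No summit, crux or item is proved by this file; Navier–Stokes regularity is NOT proved.

* §A  the group law of vertical screw-scalings ABOUT A CENTRE `c` (`isScrewAbout_refl/mul/inv/zpow`, full turns, generator powers);
* §B  THE CRYSTAL about one centre (`crystal_of`): if the rotation angles about `c` are rational with denominators bounded by `M`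
  and no screw-scaling about `c` has factor `λ ≠ 1` with `|log λ| < ρ′` (the two FLOORS — for pinned peakless profiles they are the
  skeleton's data `RotationOrderAt` (U3a) and `RotatedNearOneAt` (H1, now the theorem `Theorems/…ZeroSpin.noPinnedScrewSoliton`)), then
  the set of symmetries `(θ, λ)` about `c` is EXACTLY `{(jθ₀ + 2πk/n, e^{jℓ₀}) : j k ∈ ℤ}` with `1 ≤ n ≤ M`, `ℓ₀ = 0 ∨ ℓ₀ ≥ ρ′` — the group
  `C_n × ℤ` (a breather lattice) or `C_n`; tools `lattice_of_isolated` (Mathlib `AddSubgroup.cyclic_of_isolated_zero`), `rotationSubgroup`,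
  `logScalingSubgroup`, `rotation_lattice`, `scaling_lattice`;
* §C  GLOBAL STRUCTURE over ALL centres (NEW; Type-I ancient mild class `A_C`, no pins, no poloidality): the COMMUTATOR of two symmetries
  about centres `c₁, c₂` is the translation by `T = (I − λ₁R₁)(λ₂R₂ − I)(c₁ − c₂)` (`period_of_two_isScrewAbout`, from the tree's
  `…PointGroupCentre.translate_of_two_sims`), a spatial period, hence `T = 0` for a non-zero class element (`…Periodic.eq_zero_of_spatiallyPeriodic`);
  reading off the kernel of `I − λR_θ` (`horiz_eq_zero_of_sub_smul_rotZ`): any two HORIZONTALLY NON-TRIVIAL symmetries (`λ ≠ 1 ∨ cos θ ≠ 1`) have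
  centres on ONE vertical axis (`same_axis`), any two with `λ ≠ 1` have the SAME centre (`same_centre`; = the tree's `eq_zero_of_two_isScrewAbout`,
  re-derived from the one formula), and every symmetry re-bases to one centre (`rebase_of_scaling_centre`, `rebase_rotation`): THE SYMMETRY GROUP
  OF A NON-ZERO CLASS ELEMENT IS BASED AT ONE CENTRE ON ONE AXIS — so the crystal about that centre is the WHOLE vertical similarity group.
-/

noncomputable section

set_option linter.dupNamespace false

namespace Summit.NavierStokesRegularity.NavierStokesRegularity.Cruxes.PoloidalWindowRigidity.CrystalLattice

open Set Function Filter Topology Metric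
open Literature.Analysis Literature.Analysis.FluidPDE
open Summit.NavierStokesRegularity.NavierStokesRegularity.Theorems
open PoloidalWindowDoorPoloidalWindowRigidityNearIdentityDefs PoloidalWindowDoorPoloidalWindowRigidityNearIdentityExtraction
open PoloidalWindowDoorPoloidalWindowRigidityPointGroupCentre

/-! ## §0 Rotation bookkeeping (coordinates; light re-proofs) -/

theorem rotZ_smul_vec (θ r : ℝ) (x : EuclideanSpace ℝ (Fin 3)) : rotZ θ (r • x) = r • rotZ θ x := by
  ext i
  fin_cases i <;> simp <;> ring

theorem rotZ_add_vec (θ : ℝ) (x y : EuclideanSpace ℝ (Fin 3)) : rotZ θ (x + y) = rotZ θ x + rotZ θ y := by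
  ext i
  fin_cases i <;> simp <;> ring

theorem rotZ_sub_vec (θ : ℝ) (x y : EuclideanSpace ℝ (Fin 3)) : rotZ θ (x - y) = rotZ θ x - rotZ θ y := by
  ext i
  fin_cases i <;> simp <;> ring

/-- Full turns are the identity. -/
theorem rotZ_int_mul_two_pi (k : ℤ) (x : EuclideanSpace ℝ (Fin 3)) : rotZ ((k : ℝ) * (2 * Real.pi)) x = x := by
  have hs : Real.sin ((k : ℝ) * (2 * Real.pi)) = 0 := by
    have e : (k : ℝ) * (2 * Real.pi) = ((2 * k : ℤ) : ℝ) * Real.pi := by push_cast; ring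
    rw [e]; exact Real.sin_int_mul_pi _
  have hc : Real.cos ((k : ℝ) * (2 * Real.pi)) = 1 := Real.cos_int_mul_two_pi k
  ext i
  fin_cases i <;> simp [hs, hc]

/-- A vertical vector is fixed by every `R_θ`. -/
theorem rotZ_of_horiz_zero (θ : ℝ) {d : EuclideanSpace ℝ (Fin 3)} (h0 : d 0 = 0) (h1 : d 1 = 0) : rotZ θ d = d := by
  ext i
  fin_cases i <;> simp [h0, h1]

/-! ## §A The vertical similarity group ABOUT A CENTRE: identity, products, inverses, powers (PROVED) -/

theorem isScrewAbout_refl (c : EuclideanSpace ℝ (Fin 3)) (v : ℝ → EuclideanSpace ℝ (Fin 3) → EuclideanSpace ℝ (Fin 3)) :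
    IsScrewAbout c 0 1 v :=
  isScrew_refl _

theorem isScrewAbout_mul {c : EuclideanSpace ℝ (Fin 3)} {θ₁ θ₂ a b : ℝ} {v : ℝ → EuclideanSpace ℝ (Fin 3) → EuclideanSpace ℝ (Fin 3)}
    (h1 : IsScrewAbout c θ₁ a v) (ha : 0 < a) (h2 : IsScrewAbout c θ₂ b v) : IsScrewAbout c (θ₁ + θ₂) (a * b) v :=
  IsScrew.mul h1 ha h2

theorem isScrewAbout_inv {c : EuclideanSpace ℝ (Fin 3)} {θ a : ℝ} {v : ℝ → EuclideanSpace ℝ (Fin 3) → EuclideanSpace ℝ (Fin 3)}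
    (h : IsScrewAbout c θ a v) (ha : 0 < a) : IsScrewAbout c (-θ) a⁻¹ v :=
  IsScrew.inv h ha

theorem isScrewAbout_zpow {c : EuclideanSpace ℝ (Fin 3)} {θ a : ℝ} {v : ℝ → EuclideanSpace ℝ (Fin 3) → EuclideanSpace ℝ (Fin 3)}
    (h : IsScrewAbout c θ a v) (ha : 0 < a) (k : ℤ) : IsScrewAbout c ((k : ℝ) * θ) (a ^ k) v :=
  IsScrew.zpow h ha k

/-- Full turns are symmetries of every field about every centre. -/
theorem isScrewAbout_int_mul_two_pi (c : EuclideanSpace ℝ (Fin 3)) (v : ℝ → EuclideanSpace ℝ (Fin 3) → EuclideanSpace ℝ (Fin 3)) (k : ℤ) :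
    IsScrewAbout c ((k : ℝ) * (2 * Real.pi)) 1 v := by
  intro t ht x
  have e : -((k : ℝ) * (2 * Real.pi)) = ((-k : ℤ) : ℝ) * (2 * Real.pi) := by push_cast; ring
  simp only [one_smul, one_pow, one_mul]
  rw [rotZ_int_mul_two_pi, e, rotZ_int_mul_two_pi]

theorem exp_int_mul' (x : ℝ) (n : ℤ) : Real.exp ((n : ℝ) * x) = Real.exp x ^ n := by
  cases n with
  | ofNat n =>
      rw [Int.ofNat_eq_natCast, zpow_natCast, ← Real.exp_nat_mul]
      push_cast; rfl
  | negSucc n =>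
      rw [zpow_negSucc, ← Real.exp_nat_mul, ← Real.exp_neg, Int.cast_negSucc]
      push_cast; ring_nf

/-- Powers of a generator `g₀ = (θ₀, e^{ℓ₀})`: `g₀^j = (jθ₀, e^{jℓ₀})`. -/
theorem isScrewAbout_gen_zpow {c : EuclideanSpace ℝ (Fin 3)} {θ₀ ℓ₀ : ℝ} {v : ℝ → EuclideanSpace ℝ (Fin 3) → EuclideanSpace ℝ (Fin 3)}
    (h : IsScrewAbout c θ₀ (Real.exp ℓ₀) v) (j : ℤ) :
    IsScrewAbout c ((j : ℝ) * θ₀) (Real.exp ((j : ℝ) * ℓ₀)) v := by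
  rw [exp_int_mul']
  exact isScrewAbout_zpow h (Real.exp_pos ℓ₀) j

/-! ## §B THE CRYSTAL about one centre: the rotation lattice `(2π/n)ℤ`, the scaling lattice `ℤ·ℓ₀`, the structure theorem (PROVED)
Two subgroups of `(ℝ,+)` — the rotation angles about `c` and the logarithms of the screw-scaling factors about `c` — have ISOLATED ZERO under the two
floors, hence are CYCLIC (Mathlib `AddSubgroup.cyclic_of_isolated_zero`); the full turn `2π` lies in the first and pins its generator to `2π/n`, `n ≤ M`. -/

/-- A subgroup of `(ℝ,+)` whose positive elements are bounded below by some `a > 0` is `ℤ·b` for one generator `b ≥ 0` with `b = 0 ∨ a ≤ b`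
(Mathlib `AddSubgroup.cyclic_of_isolated_zero` + bookkeeping). -/
theorem lattice_of_isolated (H : AddSubgroup ℝ) {a : ℝ} (ha : 0 < a) (hd : ∀ x ∈ H, 0 < x → a ≤ x) :
    ∃ b : ℝ, 0 ≤ b ∧ (b = 0 ∨ a ≤ b) ∧ b ∈ H ∧ ∀ x : ℝ, x ∈ H ↔ ∃ j : ℤ, x = j * b := by
  have hdis : Disjoint (H : Set ℝ) (Set.Ioo 0 a) := by
    rw [Set.disjoint_left]
    rintro x hx ⟨h0, h1⟩
    exact absurd (hd x hx h0) (not_le.2 h1)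
  obtain ⟨b', hb'⟩ := AddSubgroup.cyclic_of_isolated_zero ha hdis
  have hmem : ∀ x : ℝ, x ∈ H ↔ ∃ j : ℤ, x = j * b' := by
    intro x
    rw [hb', AddSubgroup.mem_closure_singleton]
    constructor
    · rintro ⟨n, hn⟩
      exact ⟨n, by rw [← hn, zsmul_eq_mul]⟩
    · rintro ⟨j, hj⟩
      exact ⟨j, by rw [hj, zsmul_eq_mul]⟩
  have hb'mem : b' ∈ H := (hmem b').2 ⟨1, by simp⟩
  have habs : |b'| ∈ H := by
    rcases abs_choice b' with h | h
    · rw [h]; exact hb'mem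
    · rw [h]; exact H.neg_mem hb'mem
  refine ⟨|b'|, abs_nonneg _, ?_, habs, ?_⟩
  · by_cases h0 : b' = 0
    · exact Or.inl (by simp [h0])
    · exact Or.inr (hd _ habs (abs_pos.2 h0))
  · intro x
    rw [hmem x]
    rcases abs_choice b' with h | h
    · rw [h]
    · rw [h]
      constructor
      · rintro ⟨j, hj⟩
        exact ⟨-j, by rw [hj]; push_cast; ring⟩
      · rintro ⟨j, hj⟩
        exact ⟨-j, by rw [hj]; push_cast; ring⟩

/-- The rotation angles about the vertical axis through `c` leaving `w` invariant — a subgroup of `(ℝ,+)` (NEW object). -/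
def rotationSubgroup (c : (EuclideanSpace ℝ (Fin 3))) (w : ℝ → (EuclideanSpace ℝ (Fin 3)) → (EuclideanSpace ℝ (Fin 3))) : AddSubgroup ℝ where
  carrier := {θ | IsScrewAbout c θ 1 w}
  zero_mem' := isScrewAbout_refl c w
  add_mem' := by
    intro a b ha hb
    have h := isScrewAbout_mul ha one_pos hb
    rw [mul_one] at h
    exact h
  neg_mem' := by
    intro a ha
    have h := isScrewAbout_inv ha one_pos
    rw [inv_one] at h
    exact h

theorem mem_rotationSubgroup {c : (EuclideanSpace ℝ (Fin 3))} {w : ℝ → (EuclideanSpace ℝ (Fin 3)) → (EuclideanSpace ℝ (Fin 3))} {θ : ℝ} : θ ∈ rotationSubgroup c w ↔ IsScrewAbout c θ 1 w :=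
  Iff.rfl

/-- The logarithms of the factors of the screw-scalings about `c` leaving `w` invariant — a subgroup of `(ℝ,+)` (NEW object). -/
def logScalingSubgroup (c : (EuclideanSpace ℝ (Fin 3))) (w : ℝ → (EuclideanSpace ℝ (Fin 3)) → (EuclideanSpace ℝ (Fin 3))) : AddSubgroup ℝ where
  carrier := {ℓ | ∃ θ : ℝ, IsScrewAbout c θ (Real.exp ℓ) w}
  zero_mem' := ⟨0, by rw [Real.exp_zero]; exact isScrewAbout_refl c w⟩
  add_mem' := by
    rintro a b ⟨θ₁, h1⟩ ⟨θ₂, h2⟩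
    exact ⟨θ₁ + θ₂, by rw [Real.exp_add]; exact isScrewAbout_mul h1 (Real.exp_pos a) h2⟩
  neg_mem' := by
    rintro a ⟨θ, h⟩
    exact ⟨-θ, by rw [Real.exp_neg]; exact isScrewAbout_inv h (Real.exp_pos a)⟩

theorem mem_logScalingSubgroup {c : (EuclideanSpace ℝ (Fin 3))} {w : ℝ → (EuclideanSpace ℝ (Fin 3)) → (EuclideanSpace ℝ (Fin 3))} {ℓ : ℝ} :
    ℓ ∈ logScalingSubgroup c w ↔ ∃ θ : ℝ, IsScrewAbout c θ (Real.exp ℓ) w :=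
  Iff.rfl

theorem one_le_abs_cast {k : ℤ} (hk : k ≠ 0) : (1 : ℝ) ≤ |(k : ℝ)| := by
  rw [← Int.cast_abs]
  exact_mod_cast Int.one_le_abs hk

/-- **ROTATION LATTICE (PROVED).** Rational angles with class-uniformly bounded denominators (hypothesis `hM`; for pinned profiles the skeleton datum `RotationOrderAt`) make the rotation
group about `c` the cyclic group `(2π/n)ℤ` with `1 ≤ n ≤ M`. -/
theorem rotation_lattice {M : ℝ} {c : (EuclideanSpace ℝ (Fin 3))} {w : ℝ → (EuclideanSpace ℝ (Fin 3)) → (EuclideanSpace ℝ (Fin 3))}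
    (hM : ∀ θ : ℝ, IsScrewAbout c θ 1 w → ∃ n k : ℤ, n ≠ 0 ∧ |(n : ℝ)| ≤ M ∧ θ * n = 2 * Real.pi * k) :
    ∃ n : ℕ, 1 ≤ n ∧ (n : ℝ) ≤ M ∧ ∀ θ : ℝ, IsScrewAbout c θ 1 w ↔ ∃ k : ℤ, θ = k * (2 * Real.pi / n) := by
  obtain ⟨n0, k0, hn0, hn0M, -⟩ := hM 0 (isScrewAbout_refl c w)
  have hM1 : 1 ≤ M := le_trans (one_le_abs_cast hn0) hn0M
  have hMpos : 0 < M := by linarith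
  have h2pi_pos : (0 : ℝ) < 2 * Real.pi := by positivity
  have hiso : ∀ θ ∈ rotationSubgroup c w, 0 < θ → 2 * Real.pi / M ≤ θ := by
    intro θ hθ hθpos
    obtain ⟨n, k, hn, hnM, hθn⟩ := hM θ hθ
    have hk : k ≠ 0 := by
      rintro rfl
      have h0 : θ * n = 0 := by simpa using hθn
      rcases mul_eq_zero.1 h0 with h | h
      · exact hθpos.ne' h
      · exact hn (by exact_mod_cast h)
    have h1 : θ * |(n : ℝ)| = 2 * Real.pi * |(k : ℝ)| := by
      have h := congrArg abs hθn
      rwa [abs_mul, abs_mul, abs_of_pos hθpos, abs_of_pos h2pi_pos] at h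
    have h2 : 2 * Real.pi ≤ θ * |(n : ℝ)| := by
      rw [h1]; nlinarith [one_le_abs_cast hk, Real.pi_pos]
    rw [div_le_iff₀ hMpos]
    exact le_trans h2 (mul_le_mul_of_nonneg_left hnM hθpos.le)
  obtain ⟨b, hb0, -, hbmem, hmem⟩ := lattice_of_isolated (rotationSubgroup c w) (by positivity) hiso
  have h2pi : (2 * Real.pi) ∈ rotationSubgroup c w := by
    have h := isScrewAbout_int_mul_two_pi c w 1
    rw [Int.cast_one, one_mul] at h
    exact h
  obtain ⟨j, hj⟩ := (hmem _).1 h2pi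
  have hbne : b ≠ 0 := by
    rintro rfl
    rw [mul_zero] at hj
    exact h2pi_pos.ne' hj
  have hbpos : 0 < b := lt_of_le_of_ne hb0 (Ne.symm hbne)
  have hjposR : (0 : ℝ) < j := by
    have h : (0 : ℝ) < j * b := by rw [← hj]; exact h2pi_pos
    exact (mul_pos_iff_of_pos_right hbpos).1 h
  have hjpos : 0 < j := by exact_mod_cast hjposR
  obtain ⟨n, hn⟩ : ∃ n : ℕ, (n : ℤ) = j := ⟨j.toNat, Int.toNat_of_nonneg hjpos.le⟩
  have hn1 : 1 ≤ n := by omega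
  have hnR : (n : ℝ) = (j : ℝ) := by exact_mod_cast hn
  have hnpos : (0 : ℝ) < n := by rw [hnR]; exact hjposR
  have hbn : b = 2 * Real.pi / n := by
    rw [hnR, eq_div_iff hjposR.ne', mul_comm]
    exact hj.symm
  have hnM : (n : ℝ) ≤ M := by
    obtain ⟨n', k', hn', hn'M, hbn'⟩ := hM b hbmem
    have e : (n' : ℝ) = k' * n := by
      have h3 : b * n = 2 * Real.pi := by rw [hbn]; field_simp
      have h4 : 2 * Real.pi * n' = 2 * Real.pi * (k' * n) := by
        calc 2 * Real.pi * n' = (b * n) * n' := by rw [h3]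
          _ = (b * n') * n := by ring
          _ = 2 * Real.pi * k' * n := by rw [hbn']
          _ = 2 * Real.pi * (k' * n) := by ring
      exact mul_left_cancel₀ h2pi_pos.ne' h4
    have hk' : k' ≠ 0 := by
      rintro rfl
      rw [Int.cast_zero, zero_mul] at e
      exact hn' (by exact_mod_cast e)
    calc (n : ℝ) = 1 * n := (one_mul _).symm
      _ ≤ |(k' : ℝ)| * n := mul_le_mul_of_nonneg_right (one_le_abs_cast hk') hnpos.le
      _ = |(n' : ℝ)| := by rw [e, abs_mul, abs_of_pos hnpos]
      _ ≤ M := hn'M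
  refine ⟨n, hn1, hnM, fun θ => ?_⟩
  rw [← mem_rotationSubgroup, hmem θ, hbn]

/-- **SCALING LATTICE (PROVED).** The any-angle near-one floor (hypothesis `hR`; for pinned profiles the skeleton datum `RotatedNearOneAt`) makes the log-scaling group about `c`
the lattice `ℤ·ℓ₀` with `ℓ₀ = 0 ∨ ℓ₀ ≥ ρ'`, generated by one symmetry `(θ₀, e^{ℓ₀})`. -/
theorem scaling_lattice {ρ' : ℝ} {c : (EuclideanSpace ℝ (Fin 3))} {w : ℝ → (EuclideanSpace ℝ (Fin 3)) → (EuclideanSpace ℝ (Fin 3))} (hρ' : 0 < ρ')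
    (hR : ∀ θ lam : ℝ, 0 < lam → lam ≠ 1 → |Real.log lam| < ρ' → IsScrewAbout c θ lam w → False) :
    ∃ ℓ₀ θ₀ : ℝ, 0 ≤ ℓ₀ ∧ (ℓ₀ = 0 ∨ ρ' ≤ ℓ₀) ∧ (ℓ₀ = 0 → θ₀ = 0) ∧ IsScrewAbout c θ₀ (Real.exp ℓ₀) w ∧
      ∀ θ lam : ℝ, 0 < lam → IsScrewAbout c θ lam w → ∃ j : ℤ, lam = Real.exp ((j : ℝ) * ℓ₀) := by
  have hiso : ∀ ℓ ∈ logScalingSubgroup c w, 0 < ℓ → ρ' ≤ ℓ := by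
    rintro ℓ ⟨θ, hθ⟩ hℓ
    by_contra hlt
    push Not at hlt
    refine hR θ (Real.exp ℓ) (Real.exp_pos ℓ) ?_ ?_ hθ
    · rw [Ne, Real.exp_eq_one_iff]; exact hℓ.ne'
    · rw [Real.log_exp, abs_of_pos hℓ]; exact hlt
  obtain ⟨b, hb0, hb, hbmem, hmem⟩ := lattice_of_isolated (logScalingSubgroup c w) hρ' hiso
  have hfac : ∀ θ lam : ℝ, 0 < lam → IsScrewAbout c θ lam w → ∃ j : ℤ, lam = Real.exp ((j : ℝ) * b) := by
    intro θ lam hlam h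
    have hmemℓ : Real.log lam ∈ logScalingSubgroup c w := ⟨θ, by rw [Real.exp_log hlam]; exact h⟩
    obtain ⟨j, hj⟩ := (hmem _).1 hmemℓ
    exact ⟨j, by rw [← hj, Real.exp_log hlam]⟩
  by_cases h0 : b = 0
  · refine ⟨0, 0, le_rfl, Or.inl rfl, fun _ => rfl, by rw [Real.exp_zero]; exact isScrewAbout_refl c w, ?_⟩
    intro θ lam hlam h
    obtain ⟨j, hj⟩ := hfac θ lam hlam h
    exact ⟨j, by rw [hj, h0]⟩
  · obtain ⟨θ₁, hθ₁⟩ := (mem_logScalingSubgroup).1 hbmem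
    exact ⟨b, θ₁, hb0, hb, fun h => absurd h h0, hθ₁, hfac⟩

/-- **THE CRYSTAL about one centre (structure theorem, PROVED).** Bounded rotation orders and an any-angle near-one floor force the group of vertical
screw-scalings about `c` leaving `w` invariant to be `{(jθ₀ + 2πk/n, e^{jℓ₀})}` — `C_n × ℤ` or `C_n`. -/
theorem crystal_of {M ρ' : ℝ} {c : (EuclideanSpace ℝ (Fin 3))} {w : ℝ → (EuclideanSpace ℝ (Fin 3)) → (EuclideanSpace ℝ (Fin 3))}
    (hM : ∀ θ : ℝ, IsScrewAbout c θ 1 w → ∃ n k : ℤ, n ≠ 0 ∧ |(n : ℝ)| ≤ M ∧ θ * n = 2 * Real.pi * k)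
    (hρ' : 0 < ρ')
    (hR : ∀ θ lam : ℝ, 0 < lam → lam ≠ 1 → |Real.log lam| < ρ' → IsScrewAbout c θ lam w → False) :
    ∃ (n : ℕ) (θ₀ ℓ₀ : ℝ), 1 ≤ n ∧ (n : ℝ) ≤ M ∧ (ℓ₀ = 0 ∨ ρ' ≤ ℓ₀) ∧ (ℓ₀ = 0 → θ₀ = 0) ∧
      IsScrewAbout c θ₀ (Real.exp ℓ₀) w ∧
      ∀ θ lam : ℝ, 0 < lam →
        (IsScrewAbout c θ lam w ↔ ∃ j k : ℤ, lam = Real.exp ((j : ℝ) * ℓ₀) ∧ θ = j * θ₀ + k * (2 * Real.pi / n)) := by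
  obtain ⟨n, hn1, hnM, hrot⟩ := rotation_lattice hM
  obtain ⟨ℓ₀, θ₀, hℓ0, hℓ, hθℓ, hgen, hfac⟩ := scaling_lattice hρ' hR
  refine ⟨n, θ₀, ℓ₀, hn1, hnM, hℓ, hθℓ, hgen, fun θ lam hlam => ⟨fun h => ?_, ?_⟩⟩
  · obtain ⟨j, hj⟩ := hfac θ lam hlam h
    have hinv := isScrewAbout_gen_zpow hgen (-j)
    have hcomp := isScrewAbout_mul h hlam hinv
    have e1 : lam * Real.exp (((-j : ℤ) : ℝ) * ℓ₀) = 1 := by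
      rw [hj, ← Real.exp_add]; push_cast; ring_nf; exact Real.exp_zero
    rw [e1] at hcomp
    obtain ⟨k, hk⟩ := (hrot _).1 hcomp
    refine ⟨j, k, hj, ?_⟩
    have : θ + ((-j : ℤ) : ℝ) * θ₀ = k * (2 * Real.pi / n) := hk
    push_cast at this
    linarith
  · rintro ⟨j, k, hj, hθ⟩
    have h1 := isScrewAbout_gen_zpow hgen j
    have h2 : IsScrewAbout c ((k : ℝ) * (2 * Real.pi / n)) 1 w := (hrot _).2 ⟨k, rfl⟩
    have h := isScrewAbout_mul h1 (Real.exp_pos _) h2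
    rw [mul_one, ← hj] at h
    rw [hθ]
    exact h

/-! ## §C GLOBAL STRUCTURE over all centres (NEW, PROVED; class `A_C`, no pins): one commutator formula
For symmetries `gᵢ = (cᵢ, θᵢ, λᵢ)` (`x ↦ cᵢ + λᵢR_{θᵢ}(x − cᵢ)`) of one field the commutator `g₁g₂g₁⁻¹g₂⁻¹` is the TRANSLATION by
`T = (I − λ₁R₁)(λ₂R₂ − I)(c₁ − c₂)` (all scaled rotations about the vertical commute), a spatial period of every slice; a non-zero element of the
Type-I ancient mild class has no period (`…Periodic.eq_zero_of_spatiallyPeriodic`), so `T = 0`; and `I − λR_θ` is injective on horizontal vectors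
unless `(λ, cos θ) = (1, 1)`, and on vertical vectors unless `λ = 1`. -/

/-- Sim form of a screw-scaling symmetry about a centre: `v(t, y) = λ R_{−θ} v(λ²t, λR_θ y + b)` with `b = c − λR_θ c`. -/
theorem simForm_of_isScrewAbout {c : EuclideanSpace ℝ (Fin 3)} {θ lam : ℝ} {v : ℝ → EuclideanSpace ℝ (Fin 3) → EuclideanSpace ℝ (Fin 3)}
    (h : IsScrewAbout c θ lam v) :
    ∀ t < 0, ∀ y, v t y = lam • rotZ (-θ) (v (lam ^ 2 * t) (lam • rotZ θ y + (c - lam • rotZ θ c))) := by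
  intro t ht y
  have key := h t ht (y - c)
  simp only [sub_add_cancel] at key
  have e : lam • rotZ θ (y - c) + c = lam • rotZ θ y + (c - lam • rotZ θ c) := by
    rw [rotZ_sub_vec, smul_sub]; abel
  rw [key, e]

/-- **THE COMMUTATOR PERIOD.** Two screw-scaling symmetries about centres `c₁, c₂` give the spatial period
`T = (I − λ₁R₁)((λ₂R₂ − I)(c₁ − c₂))` of every slice. -/
theorem period_of_two_isScrewAbout {c₁ c₂ : EuclideanSpace ℝ (Fin 3)} {θ₁ θ₂ l₁ l₂ : ℝ}
    {v : ℝ → EuclideanSpace ℝ (Fin 3) → EuclideanSpace ℝ (Fin 3)} (hl₁ : 0 < l₁) (hl₂ : 0 < l₂)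
    (h1 : IsScrewAbout c₁ θ₁ l₁ v) (h2 : IsScrewAbout c₂ θ₂ l₂ v) :
    ∀ s < 0, ∀ z, v s (z + ((l₂ • rotZ θ₂ (c₁ - c₂) - (c₁ - c₂)) - l₁ • rotZ θ₁ (l₂ • rotZ θ₂ (c₁ - c₂) - (c₁ - c₂)))) = v s z := by
  have hT := translate_of_two_sims (simForm_of_isScrewAbout h1) (simForm_of_isScrewAbout h2) hl₁ hl₂
  have e : (l₂ • rotZ θ₂ (c₁ - l₁ • rotZ θ₁ c₁) + (c₂ - l₂ • rotZ θ₂ c₂)) - (l₁ • rotZ θ₁ (c₂ - l₂ • rotZ θ₂ c₂) + (c₁ - l₁ • rotZ θ₁ c₁)) =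
      (l₂ • rotZ θ₂ (c₁ - c₂) - (c₁ - c₂)) - l₁ • rotZ θ₁ (l₂ • rotZ θ₂ (c₁ - c₂) - (c₁ - c₂)) := by
    ext i
    fin_cases i <;> simp <;> ring
  intro s hs z
  have := hT s hs z
  rwa [e] at this

/-- Kernel of `I − λR_θ` on horizontal components: trivial unless `λ = 1 ∧ cos θ = 1`. -/
theorem horiz_eq_zero_of_sub_smul_rotZ {l θ : ℝ} (hl : 0 < l) (hnt : l ≠ 1 ∨ Real.cos θ ≠ 1) {u : EuclideanSpace ℝ (Fin 3)}
    (h0 : (u - l • rotZ θ u) 0 = 0) (h1 : (u - l • rotZ θ u) 1 = 0) : u 0 = 0 ∧ u 1 = 0 := by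
  have e0 : (1 - l * Real.cos θ) * u 0 + l * Real.sin θ * u 1 = 0 := by
    have := h0; simp at this; linarith
  have e1 : -(l * Real.sin θ) * u 0 + (1 - l * Real.cos θ) * u 1 = 0 := by
    have := h1; simp at this; linarith
  set D : ℝ := (1 - l * Real.cos θ) ^ 2 + (l * Real.sin θ) ^ 2 with hD
  have hDne : D ≠ 0 := by
    intro hD0
    have hs : l * Real.sin θ = 0 := by nlinarith [sq_nonneg (1 - l * Real.cos θ), sq_nonneg (l * Real.sin θ)]
    have hc : 1 - l * Real.cos θ = 0 := by nlinarith [sq_nonneg (1 - l * Real.cos θ), sq_nonneg (l * Real.sin θ)]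
    have hsin : Real.sin θ = 0 := by
      rcases mul_eq_zero.1 hs with h | h
      · exact absurd h hl.ne'
      · exact h
    have hcos2 : Real.cos θ ^ 2 = 1 := by nlinarith [Real.sin_sq_add_cos_sq θ]
    have hlc : l * Real.cos θ = 1 := by linarith
    have hcos : Real.cos θ = 1 := by
      have h' : (Real.cos θ - 1) * (Real.cos θ + 1) = 0 := by nlinarith
      rcases mul_eq_zero.1 h' with h | h
      · linarith
      · exfalso; have : Real.cos θ = -1 := by linarith
        rw [this] at hlc; linarith
    have hl1 : l = 1 := by rw [hcos, mul_one] at hlc; exact hlc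
    rcases hnt with h | h
    · exact h hl1
    · exact h hcos
  have k0 : D * u 0 = 0 := by
    have : D * u 0 = (1 - l * Real.cos θ) * ((1 - l * Real.cos θ) * u 0 + l * Real.sin θ * u 1)
        - (l * Real.sin θ) * (-(l * Real.sin θ) * u 0 + (1 - l * Real.cos θ) * u 1) := by rw [hD]; ring
    rw [this, e0, e1]; ring
  have k1 : D * u 1 = 0 := by
    have : D * u 1 = (l * Real.sin θ) * ((1 - l * Real.cos θ) * u 0 + l * Real.sin θ * u 1)
        + (1 - l * Real.cos θ) * (-(l * Real.sin θ) * u 0 + (1 - l * Real.cos θ) * u 1) := by rw [hD]; ring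
    rw [this, e0, e1]; ring
  exact ⟨(mul_eq_zero.1 k0).resolve_left hDne, (mul_eq_zero.1 k1).resolve_left hDne⟩

/-- Vertical component of `u − λR_θ u` is `(1 − λ) u₂`. -/
theorem vert_sub_smul_rotZ (l θ : ℝ) (u : EuclideanSpace ℝ (Fin 3)) : (u - l • rotZ θ u) 2 = (1 - l) * u 2 := by
  simp; ring

/-- **NO PERIOD:** a non-zero element of the Type-I ancient mild class has no spatial period (tree `…Periodic.eq_zero_of_spatiallyPeriodic`). -/
theorem period_eq_zero {C : ℝ} {v : ℝ → EuclideanSpace ℝ (Fin 3) → EuclideanSpace ℝ (Fin 3)} (hv : IsTypeIAncientMild C v)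
    (hne : ∃ t < 0, ∃ x, v t x ≠ 0) {ℓ : EuclideanSpace ℝ (Fin 3)} (hper : ∀ s < 0, ∀ y, v s (y + ℓ) = v s y) : ℓ = 0 := by
  by_contra hℓ
  obtain ⟨t, ht, x, hx⟩ := hne
  exact hx (PoloidalWindowDoorPoloidalWindowRigidityPeriodic.eq_zero_of_spatiallyPeriodic hv.2.2.2 hv.1.continuousOn
    (fun s t hst ht x => hv.mild_eq_heatExtension hst ht x) hv.2.1 hℓ hper t ht x)

/-- **THE COMMUTATOR VANISHES** for a non-zero class element: `(I − λ₁R₁)((λ₂R₂ − I)(c₁ − c₂)) = 0`. -/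
theorem commutator_eq_zero {C : ℝ} {v : ℝ → EuclideanSpace ℝ (Fin 3) → EuclideanSpace ℝ (Fin 3)} (hv : IsTypeIAncientMild C v)
    (hne : ∃ t < 0, ∃ x, v t x ≠ 0) {c₁ c₂ : EuclideanSpace ℝ (Fin 3)} {θ₁ θ₂ l₁ l₂ : ℝ} (hl₁ : 0 < l₁) (hl₂ : 0 < l₂)
    (h1 : IsScrewAbout c₁ θ₁ l₁ v) (h2 : IsScrewAbout c₂ θ₂ l₂ v) :
    (l₂ • rotZ θ₂ (c₁ - c₂) - (c₁ - c₂)) - l₁ • rotZ θ₁ (l₂ • rotZ θ₂ (c₁ - c₂) - (c₁ - c₂)) = 0 :=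
  period_eq_zero hv hne (period_of_two_isScrewAbout hl₁ hl₂ h1 h2)

/-- **ONE AXIS (PROVED, class level).** Two HORIZONTALLY NON-TRIVIAL symmetries (`λᵢ ≠ 1 ∨ cos θᵢ ≠ 1`) of a non-zero class element have their
centres on ONE vertical axis.  (For `λ₁ = λ₂ = 1` this is the tree's `ScenarioCensus.RotationOrder.row_Apa2T_holds`; for `θ₂ = 0` its
`row_AdsT_holds`; here all cases drop out of the one commutator formula.) -/
theorem same_axis {C : ℝ} {v : ℝ → EuclideanSpace ℝ (Fin 3) → EuclideanSpace ℝ (Fin 3)} (hv : IsTypeIAncientMild C v)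
    (hne : ∃ t < 0, ∃ x, v t x ≠ 0) {c₁ c₂ : EuclideanSpace ℝ (Fin 3)} {θ₁ θ₂ l₁ l₂ : ℝ} (hl₁ : 0 < l₁) (hl₂ : 0 < l₂)
    (hnt₁ : l₁ ≠ 1 ∨ Real.cos θ₁ ≠ 1) (hnt₂ : l₂ ≠ 1 ∨ Real.cos θ₂ ≠ 1)
    (h1 : IsScrewAbout c₁ θ₁ l₁ v) (h2 : IsScrewAbout c₂ θ₂ l₂ v) : c₁ 0 = c₂ 0 ∧ c₁ 1 = c₂ 1 := by
  have hT := commutator_eq_zero hv hne hl₁ hl₂ h1 h2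
  set u : EuclideanSpace ℝ (Fin 3) := l₂ • rotZ θ₂ (c₁ - c₂) - (c₁ - c₂) with hu
  have hu0 : u 0 = 0 ∧ u 1 = 0 :=
    horiz_eq_zero_of_sub_smul_rotZ hl₁ hnt₁ (by rw [hT]; rfl) (by rw [hT]; rfl)
  -- `u = −(d − λ₂R₂ d)` with `d = c₁ − c₂`
  have hd : ((c₁ - c₂) - l₂ • rotZ θ₂ (c₁ - c₂)) 0 = 0 ∧ ((c₁ - c₂) - l₂ • rotZ θ₂ (c₁ - c₂)) 1 = 0 := by
    have e : (c₁ - c₂) - l₂ • rotZ θ₂ (c₁ - c₂) = -u := by rw [hu]; abel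
    rw [e]
    exact ⟨by simp [hu0.1], by simp [hu0.2]⟩
  have h := horiz_eq_zero_of_sub_smul_rotZ hl₂ hnt₂ hd.1 hd.2
  constructor
  · have := h.1; simp at this; linarith
  · have := h.2; simp at this; linarith

/-- **ONE CENTRE (PROVED, class level).** Two symmetries with factors `λ₁, λ₂ ≠ 1` of a non-zero class element have the SAME centre
(the tree's `…PointGroupCentre.eq_zero_of_two_isScrewAbout`, re-derived from the commutator formula). -/
theorem same_centre {C : ℝ} {v : ℝ → EuclideanSpace ℝ (Fin 3) → EuclideanSpace ℝ (Fin 3)} (hv : IsTypeIAncientMild C v)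
    (hne : ∃ t < 0, ∃ x, v t x ≠ 0) {c₁ c₂ : EuclideanSpace ℝ (Fin 3)} {θ₁ θ₂ l₁ l₂ : ℝ} (hl₁ : 0 < l₁) (hl₂ : 0 < l₂)
    (hne₁ : l₁ ≠ 1) (hne₂ : l₂ ≠ 1) (h1 : IsScrewAbout c₁ θ₁ l₁ v) (h2 : IsScrewAbout c₂ θ₂ l₂ v) : c₁ = c₂ := by
  have hh := same_axis hv hne hl₁ hl₂ (Or.inl hne₁) (Or.inl hne₂) h1 h2
  have hT := commutator_eq_zero hv hne hl₁ hl₂ h1 h2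
  have h2c : ((l₂ • rotZ θ₂ (c₁ - c₂) - (c₁ - c₂)) - l₁ • rotZ θ₁ (l₂ • rotZ θ₂ (c₁ - c₂) - (c₁ - c₂))) 2 = 0 := by rw [hT]; rfl
  rw [vert_sub_smul_rotZ] at h2c
  have h2c' : (l₂ • rotZ θ₂ (c₁ - c₂) - (c₁ - c₂)) 2 = (l₂ - 1) * (c₁ 2 - c₂ 2) := by simp; ring
  rw [h2c'] at h2c
  have hd2 : c₁ 2 - c₂ 2 = 0 := by
    rcases mul_eq_zero.1 h2c with h | h
    · exact absurd (by linarith : l₁ = 1) hne₁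
    · rcases mul_eq_zero.1 h with h' | h'
      · exact absurd (by linarith : l₂ = 1) hne₂
      · exact h'
  ext i
  fin_cases i
  · exact hh.1
  · exact hh.2
  · simpa [sub_eq_zero] using hd2

/-- Rotations about an axis do not depend on the base point on the axis: a `λ = 1` symmetry about `c` is one about any `c'` on the vertical line
through `c`. -/
theorem rebase_rotation {c c' : EuclideanSpace ℝ (Fin 3)} {θ : ℝ} {v : ℝ → EuclideanSpace ℝ (Fin 3) → EuclideanSpace ℝ (Fin 3)}
    (h : IsScrewAbout c θ 1 v) (h0 : c 0 = c' 0) (h1 : c 1 = c' 1) : IsScrewAbout c' θ 1 v := by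
  intro t ht x
  have hfix : rotZ θ (c' - c) = c' - c := rotZ_of_horiz_zero θ (by simp [h0]) (by simp [h1])
  have key := h t ht (x + (c' - c))
  simp only [one_smul, one_pow, one_mul] at key ⊢
  have e1 : x + (c' - c) + c = x + c' := by abel
  have e2 : rotZ θ (x + (c' - c)) + c = rotZ θ x + c' := by rw [rotZ_add_vec, hfix]; abel
  rw [e1, e2] at key
  exact key

/-- **THE GROUP IS BASED AT ONE CENTRE (PROVED, class level).** If a non-zero class element has a symmetry with factor `λ₀ ≠ 1` about `c₀`
(a DSS / breather generator), then EVERY horizontally non-trivial symmetry about ANY centre is a symmetry about `c₀` with the same `(θ, λ)`: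
the crystal about `c₀` is the whole vertical similarity group. -/
theorem rebase_of_scaling_centre {C : ℝ} {v : ℝ → EuclideanSpace ℝ (Fin 3) → EuclideanSpace ℝ (Fin 3)} (hv : IsTypeIAncientMild C v)
    (hne : ∃ t < 0, ∃ x, v t x ≠ 0) {c₀ : EuclideanSpace ℝ (Fin 3)} {θ₀ l₀ : ℝ} (hl₀ : 0 < l₀) (hne₀ : l₀ ≠ 1)
    (h0 : IsScrewAbout c₀ θ₀ l₀ v) {c : EuclideanSpace ℝ (Fin 3)} {θ lam : ℝ} (hl : 0 < lam) (hnt : lam ≠ 1 ∨ Real.cos θ ≠ 1)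
    (h : IsScrewAbout c θ lam v) : IsScrewAbout c₀ θ lam v := by
  by_cases hl1 : lam = 1
  · subst hl1
    have hax := same_axis hv hne hl hl₀ hnt (Or.inl hne₀) h h0
    exact rebase_rotation h hax.1 hax.2
  · have hc := same_centre hv hne hl hl₀ hl1 hne₀ h h0
    rw [← hc]; exact h

/-- **ONE AXIS FOR ALL ROTATIONS (PROVED, class level).** Two non-trivial pure rotational symmetries (`cos θᵢ ≠ 1`) of a non-zero class element
about centres `c₁, c₂` share the axis, so each is also a symmetry about the other's centre. -/
theorem rebase_of_rotation_centre {C : ℝ} {v : ℝ → EuclideanSpace ℝ (Fin 3) → EuclideanSpace ℝ (Fin 3)} (hv : IsTypeIAncientMild C v)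
    (hne : ∃ t < 0, ∃ x, v t x ≠ 0) {c₁ c₂ : EuclideanSpace ℝ (Fin 3)} {θ₁ θ₂ : ℝ} (hnt₁ : Real.cos θ₁ ≠ 1) (hnt₂ : Real.cos θ₂ ≠ 1)
    (h1 : IsScrewAbout c₁ θ₁ 1 v) (h2 : IsScrewAbout c₂ θ₂ 1 v) : IsScrewAbout c₁ θ₂ 1 v := by
  have hax := same_axis hv hne one_pos one_pos (Or.inr hnt₁) (Or.inr hnt₂) h1 h2
  exact rebase_rotation h2 hax.1.symm hax.2.symm

end Summit.NavierStokesRegularity.NavierStokesRegularity.Cruxes.PoloidalWindowRigidity.CrystalLattice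

end
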